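import Mathlib
import HarnessLib

/-!
# Crux `MobiusLadder.LiouvilleOrthogonalTC0` (stmt-QuantumAdvantage-1393), line `Sketch`, skeleton v7:
# stub `stub_blockInfluence` — block influence is at most total influence

For an arbitrary Boolean function `G : {0,1}ⁿ → {0,1}` and an arbitrary map `π : Fin n → Fin m`
(a partition of the `n` variables into the `m` blocks `π⁻¹(j)`), the number of pairs `(x, j)` such
that flipping all the bits of block `π⁻¹(j)` changes `G x` is at most the total influence of `G`,
i.e. the number of pairs `(x, i)` such that flipping bit `i` changes `G x`.

Proof (path argument). For a finite set `S` of coordinates write `x ⊕ 1_S` for `x` with the bits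
of `S` flipped. By induction on `S`, the number of points `x` with `G x ≠ G (x ⊕ 1_S)` is at most
`Σ_{i ∈ S} #{x : G x ≠ G (x ⊕ e_i)}`: passing from `S` to `insert i S` one flips `S` first and
then bit `i`, and pointwise `[G x ≠ G z] ≤ [G y ≠ G z] + [G x ≠ G y]` with `y = x ⊕ 1_S`,
`z = y ⊕ e_i = x ⊕ 1_{insert i S}`; the first term is re-counted over `y` through the involution
`x ↦ x ⊕ 1_S` of the cube. Summing the bound over the blocks `S_j = π⁻¹(j)`, which partition the
coordinates (`Finset.sum_fiberwise`), gives the claim.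
-/

set_option linter.dupNamespace false -- D-0017: single-problem summit ⇒ `QuantumAdvantage.QuantumAdvantage` by design

noncomputable section

namespace Summit.QuantumAdvantage.QuantumAdvantage.Theorems.LiouvilleOrthogonalTC0

open Finset

namespace BlockInfluence

/-- The triangle inequality for the discrete metric on `Bool`, in indicator form:
`[a ≠ c] ≤ [b ≠ c] + [a ≠ b]`. -/
theorem ite_ne_le (a b c : Bool) :
    (if a ≠ c then 1 else 0 : ℕ) ≤ (if b ≠ c then 1 else 0 : ℕ) + (if a ≠ b then 1 else 0 : ℕ) := by
  revert a b c
  decide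

/-- Flipping the bits of `S` and then bit `i ∉ S` is flipping the bits of `insert i S`. -/
theorem update_flip_eq {n : ℕ} (S : Finset (Fin n)) {i : Fin n} (hi : i ∉ S)
    (x : Fin n → Bool) :
    Function.update (fun l => xor (x l) (decide (l ∈ S))) i (!(xor (x i) (decide (i ∈ S))))
      = fun l => xor (x l) (decide (l ∈ insert i S)) := by
  funext l
  by_cases hl : l = i
  · subst hl
    simp [hi]
  · simp [Finset.mem_insert, hl]

/-- Flipping the bits of a fixed set `S` of coordinates is an involution of the cube. -/
theorem flip_involutive {n : ℕ} (S : Finset (Fin n)) :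
    Function.Involutive (fun x : Fin n → Bool => fun l => xor (x l) (decide (l ∈ S))) := by
  intro x
  funext l
  show xor (xor (x l) (decide (l ∈ S))) (decide (l ∈ S)) = x l
  rw [Bool.xor_assoc, Bool.xor_self, Bool.xor_false]

/-- **The path inequality.** For every finite set `S` of coordinates, the number of points `x` at
which flipping all the bits of `S` changes `G` is at most `Σ_{i ∈ S} #{x : G x ≠ G (x ⊕ e_i)}`
(indicator sums over the cube, in `ℕ`). -/
theorem sum_flip_le {n : ℕ} (G : (Fin n → Bool) → Bool) (S : Finset (Fin n)) :
    ∑ x : Fin n → Bool, (if G x ≠ G (fun l => xor (x l) (decide (l ∈ S))) then 1 else 0 : ℕ)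
      ≤ ∑ i ∈ S, ∑ x : Fin n → Bool,
          (if G x ≠ G (Function.update x i (!x i)) then 1 else 0 : ℕ) := by
  induction S using Finset.induction_on with
  | empty => simp
  | insert i S hi ih =>
    rw [Finset.sum_insert hi]
    calc ∑ x : Fin n → Bool,
          (if G x ≠ G (fun l => xor (x l) (decide (l ∈ insert i S))) then 1 else 0 : ℕ)
        ≤ ∑ x : Fin n → Bool,
            ((if G (fun l => xor (x l) (decide (l ∈ S)))
                  ≠ G (Function.update (fun l => xor (x l) (decide (l ∈ S))) i
                      (!(xor (x i) (decide (i ∈ S))))) then 1 else 0 : ℕ)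
              + (if G x ≠ G (fun l => xor (x l) (decide (l ∈ S))) then 1 else 0 : ℕ)) := by
          refine Finset.sum_le_sum fun x _ => ?_
          rw [update_flip_eq S hi x]
          exact ite_ne_le _ _ _
      _ = ∑ x : Fin n → Bool, (if G x ≠ G (Function.update x i (!x i)) then 1 else 0 : ℕ)
            + ∑ x : Fin n → Bool,
                (if G x ≠ G (fun l => xor (x l) (decide (l ∈ S))) then 1 else 0 : ℕ) := by
          rw [Finset.sum_add_distrib]
          congr 1
          exact (flip_involutive S).bijective.sum_comp
            (fun y : Fin n → Bool => (if G y ≠ G (Function.update y i (!y i)) then 1 else 0 : ℕ))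
      _ ≤ _ := Nat.add_le_add_left ih _

/-- The path inequality for the block cut out by a decidable predicate `p` on the coordinates:
`#{x : G x ≠ G (x ⊕ 1_{p})} ≤ Σ_{i : p i} #{x : G x ≠ G (x ⊕ e_i)}`. -/
theorem sum_flip_le_filter {n : ℕ} (G : (Fin n → Bool) → Bool) (p : Fin n → Prop)
    [DecidablePred p] :
    ∑ x : Fin n → Bool, (if G x ≠ G (fun l => xor (x l) (decide (p l))) then 1 else 0 : ℕ)
      ≤ ∑ i ∈ univ.filter p, ∑ x : Fin n → Bool,
          (if G x ≠ G (Function.update x i (!x i)) then 1 else 0 : ℕ) := by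
  have h := sum_flip_le G (univ.filter p)
  have e : ∀ l : Fin n, decide (l ∈ univ.filter p) = decide (p l) := fun l => by simp
  simpa only [e] using h

end BlockInfluence

open BlockInfluence in
/-- **Stub `stub_blockInfluence` (line `Sketch`, v7) — block influence is at most total
influence.** For every Boolean function `G` on `n` bits and every map `π : Fin n → Fin m`
(blocks `π⁻¹(j)`), the number of pairs `(x, j)` with `G x ≠ G (x with block j flipped)` is at
most the number of pairs `(x, i)` with `G x ≠ G (x with bit i flipped)`. Here
`fun i => xor (x i) (decide (π i = j))` is `x` with block `j` flipped and
`Function.update x i (!x i)` is `x` with bit `i` flipped. -/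
theorem stub_blockInfluence {n m : ℕ} (G : (Fin n → Bool) → Bool) (π : Fin n → Fin m) :
    ∑ x : Fin n → Bool, ((univ.filter fun j : Fin m =>
        G x ≠ G (fun i => xor (x i) (decide (π i = j)))).card : ℝ)
      ≤ ∑ i : Fin n, ((univ.filter fun x : Fin n → Bool =>
          G x ≠ G (Function.update x i (!x i))).card : ℝ) := by
  have key : ∑ x : Fin n → Bool, (univ.filter fun j : Fin m =>
        G x ≠ G (fun i => xor (x i) (decide (π i = j)))).card
      ≤ ∑ i : Fin n, (univ.filter fun x : Fin n → Bool =>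
          G x ≠ G (Function.update x i (!x i))).card := by
    calc ∑ x : Fin n → Bool, (univ.filter fun j : Fin m =>
            G x ≠ G (fun i => xor (x i) (decide (π i = j)))).card
        = ∑ x : Fin n → Bool, ∑ j : Fin m,
            (if G x ≠ G (fun i => xor (x i) (decide (π i = j))) then 1 else 0 : ℕ) := by
          simp only [Finset.card_filter]
      _ = ∑ j : Fin m, ∑ x : Fin n → Bool,
            (if G x ≠ G (fun i => xor (x i) (decide (π i = j))) then 1 else 0 : ℕ) :=
          Finset.sum_comm
      _ ≤ ∑ j : Fin m, ∑ i ∈ univ.filter (fun i => π i = j), ∑ x : Fin n → Bool,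
            (if G x ≠ G (Function.update x i (!x i)) then 1 else 0 : ℕ) :=
          Finset.sum_le_sum fun j _ => sum_flip_le_filter G (fun i => π i = j)
      _ = ∑ i : Fin n, ∑ x : Fin n → Bool,
            (if G x ≠ G (Function.update x i (!x i)) then 1 else 0 : ℕ) :=
          Finset.sum_fiberwise univ π _
      _ = ∑ i : Fin n, (univ.filter fun x : Fin n → Bool =>
            G x ≠ G (Function.update x i (!x i))).card := by
          simp only [Finset.card_filter]
  exact_mod_cast key

end Summit.QuantumAdvantage.QuantumAdvantage.Theorems.LiouvilleOrthogonalTC0
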